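import Summits.AtomisticToContinuum.Crystallization.Theorems.ExcessDecayLiouvilleCurrenciesSum
import Summits.AtomisticToContinuum.Crystallization.Theorems.ExcessDecayLiouvilleEnvelopeMasses

/-!
# Route `ExcessDecayLiouville`: gradient far masses through the dyadic `NN` currency (nonlinear half, XXII)

Harmonic-replacement architecture for item `ExcessDecay` (stmt-AtomisticToContinuum-9334), nonlinear half.
The gradient far mass `𝐉[Δ_τ v, Y]` of the step field is the dyadic sum `Σ_n (2ⁿY)⁻⁸ c_τ NN[v, 2^{n+1}Y + 3]`
(`farMass_diff_le_dyadic_NN`); the near radii (`32a ≤ r`) carry the polynomial gradient currency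
`NN[v, a] ≤ Σ_k q_k a^k` (`k ≤ 7`, from `NN_le_currency`), the far radii the global bound `NN_tot`.
* `dyadic_monomial_sum_le` : `Σ_{n ≤ K} (2ⁿY)⁻⁸ (2^{n+1}Y + 3)^k ≤ 2·4^k Y^k / Y⁸` (`k ≤ 7`, `Y ≥ 3`);
* `dyadic_far_sum_le` : `Σ_{n ≤ K, 2^{n+1}Y + 3 > r/32} (2ⁿY)⁻⁸ ≤ 256 / ((r/64)⁷ Y)` (`r ≥ 192`);
* `farMass_diff_le_poly` : the resulting bound of a dyadic `NN` sum by the polynomial currency.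
All `[folklore]`; helper lemmas, nothing here closes an item.
-/

noncomputable section

namespace Summit.AtomisticToContinuum.Crystallization.Theorems.ExcessDecayLiouville

open scoped BigOperators Topology Classical

/-- **Dyadic sum of a monomial**: `Σ_{n ≤ K} (2ⁿY)⁻⁸ (2^{n+1}Y + 3)^k ≤ 2·4^k·Y^k/Y⁸` for `k ≤ 7`, `Y ≥ 3`.
[folklore] -/
theorem dyadic_monomial_sum_le {Y : ℝ} (hY : 3 ≤ Y) {k : ℕ} (hk : k ≤ 7) (K : ℕ) :
    ∑ n ∈ Finset.range (K + 1), ((2 : ℝ) ^ n * Y)⁻¹ ^ 8 * (2 ^ (n + 1) * Y + 3) ^ k ≤ 2 * 4 ^ k * Y ^ k / Y ^ 8 := by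
  have hY0 : 0 < Y := by linarith
  have hterm : ∀ n : ℕ, ((2 : ℝ) ^ n * Y)⁻¹ ^ 8 * (2 ^ (n + 1) * Y + 3) ^ k ≤ 4 ^ k * Y ^ k / Y ^ 8 * ((2 : ℝ) ^ n)⁻¹ := by
    intro n
    have h2n : (1 : ℝ) ≤ 2 ^ n := one_le_pow₀ (by norm_num)
    have h2n0 : (0 : ℝ) < 2 ^ n := by positivity
    -- 2^{n+1} Y + 3 ≤ 2^{n+2} Y
    have h3 : (3 : ℝ) ≤ 2 ^ (n + 1) * Y := by rw [pow_succ]; nlinarith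
    have hb : (2 : ℝ) ^ (n + 1) * Y + 3 ≤ 4 * (2 ^ n * Y) := by rw [pow_succ] at h3 ⊢; nlinarith
    have hb0 : (0 : ℝ) ≤ 2 ^ (n + 1) * Y + 3 := by positivity
    -- 2^{nk} ≤ 2^{7n}
    have hpow : ((2 : ℝ) ^ n) ^ k ≤ (2 ^ n) ^ 7 := pow_le_pow_right₀ h2n hk
    calc ((2 : ℝ) ^ n * Y)⁻¹ ^ 8 * (2 ^ (n + 1) * Y + 3) ^ k
        ≤ ((2 : ℝ) ^ n * Y)⁻¹ ^ 8 * (4 * (2 ^ n * Y)) ^ k := by gcongr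
      _ = 4 ^ k * Y ^ k / Y ^ 8 * (((2 : ℝ) ^ n) ^ k / (2 ^ n) ^ 8) := by
          rw [mul_pow, inv_pow, mul_pow, mul_pow]
          field_simp
      _ ≤ 4 ^ k * Y ^ k / Y ^ 8 * (((2 : ℝ) ^ n) ^ 7 / (2 ^ n) ^ 8) := by gcongr
      _ = 4 ^ k * Y ^ k / Y ^ 8 * ((2 : ℝ) ^ n)⁻¹ := by
          congr 1
          rw [show ((2 : ℝ) ^ n) ^ 8 = (2 ^ n) ^ 7 * 2 ^ n by ring, div_mul_eq_div_div, div_self (by positivity), one_div]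
  have hgeom : ∑ n ∈ Finset.range (K + 1), ((2 : ℝ) ^ n)⁻¹ ≤ 2 := by
    have : ∑ n ∈ Finset.range (K + 1), ((2 : ℝ) ^ n)⁻¹ = ∑ n ∈ Finset.range (K + 1), (1 / 2 : ℝ) ^ n :=
      Finset.sum_congr rfl fun n _ => by rw [one_div, inv_pow]
    rw [this]; exact sum_geometric_two_le _
  calc _ ≤ ∑ n ∈ Finset.range (K + 1), 4 ^ k * Y ^ k / Y ^ 8 * ((2 : ℝ) ^ n)⁻¹ := Finset.sum_le_sum fun n _ => hterm n
    _ = 4 ^ k * Y ^ k / Y ^ 8 * ∑ n ∈ Finset.range (K + 1), ((2 : ℝ) ^ n)⁻¹ := by rw [Finset.mul_sum]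
    _ ≤ 4 ^ k * Y ^ k / Y ^ 8 * 2 := mul_le_mul_of_nonneg_left hgeom (by positivity)
    _ = _ := by ring

/-- **Dyadic sum over the far radii**: the radii `2^{n+1}Y + 3 > r/32` (`r ≥ 192`, so `2^{n+1}Y > r/64`) give
`Σ (2ⁿY)⁻⁸ ≤ 256/((r/64)⁷ Y)`. [folklore] -/
theorem dyadic_far_sum_le {Y r : ℝ} (hY : 0 < Y) (hr : 192 ≤ r) (K : ℕ) :
    ∑ n ∈ Finset.range (K + 1), (if r < 32 * (2 ^ (n + 1) * Y + 3) then ((2 : ℝ) ^ n * Y)⁻¹ ^ 8 else 0) ≤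
      256 / ((r / 64) ^ 7 * Y) := by
  have hR : 0 < r / 64 := by linarith
  have hterm : ∀ n : ℕ, (if r < 32 * (2 ^ (n + 1) * Y + 3) then ((2 : ℝ) ^ n * Y)⁻¹ ^ 8 else 0) ≤
      128 / ((r / 64) ^ 7 * Y) * ((2 : ℝ) ^ n)⁻¹ := by
    intro n
    have h2n0 : (0 : ℝ) < 2 ^ n := by positivity
    have ht0 : 0 ≤ 128 / ((r / 64) ^ 7 * Y) * ((2 : ℝ) ^ n)⁻¹ := by positivity
    split_ifs with h
    · have hn' : r / 64 < 2 ^ (n + 1) * Y := by linarith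
      have hw0 : 0 ≤ ((2 : ℝ) ^ n * Y)⁻¹ ^ 8 := by positivity
      have hratio : 1 ≤ 2 ^ (n + 1) * Y / (r / 64) := by rw [le_div_iff₀ hR, one_mul]; exact hn'.le
      have h1 : ((2 : ℝ) ^ n * Y)⁻¹ ^ 8 ≤ ((2 : ℝ) ^ n * Y)⁻¹ ^ 8 * (2 ^ (n + 1) * Y / (r / 64)) ^ 7 :=
        le_mul_of_one_le_right hw0 (one_le_pow₀ hratio)
      have h2 : ((2 : ℝ) ^ n * Y)⁻¹ ^ 8 * (2 ^ (n + 1) * Y / (r / 64)) ^ 7 = 128 / ((r / 64) ^ 7 * Y) * ((2 : ℝ) ^ n)⁻¹ := by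
        field_simp
        ring
      exact h1.trans h2.le
    · exact ht0
  have hgeom : ∑ n ∈ Finset.range (K + 1), ((2 : ℝ) ^ n)⁻¹ ≤ 2 := by
    have : ∑ n ∈ Finset.range (K + 1), ((2 : ℝ) ^ n)⁻¹ = ∑ n ∈ Finset.range (K + 1), (1 / 2 : ℝ) ^ n :=
      Finset.sum_congr rfl fun n _ => by rw [one_div, inv_pow]
    rw [this]; exact sum_geometric_two_le _
  calc _ ≤ ∑ n ∈ Finset.range (K + 1), 128 / ((r / 64) ^ 7 * Y) * ((2 : ℝ) ^ n)⁻¹ := Finset.sum_le_sum fun n _ => hterm n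
    _ = 128 / ((r / 64) ^ 7 * Y) * ∑ n ∈ Finset.range (K + 1), ((2 : ℝ) ^ n)⁻¹ := by rw [Finset.mul_sum]
    _ ≤ 128 / ((r / 64) ^ 7 * Y) * 2 := mul_le_mul_of_nonneg_left hgeom (by positivity)
    _ = _ := by ring

/-- **A dyadic `NN` sum against a polynomial currency** (degrees `1, 2, 3, 4, 5`): if
`NN(a) ≤ q₁ a + q₂ a² + q₃ a³ + q₄ a⁴ + q₅ a⁵` for `Y ≤ a`, `32a ≤ r`, and `NN(a) ≤ N_tot` always, then
`Σ_{n ≤ K} (2ⁿY)⁻⁸ NN(2^{n+1}Y + 3) ≤ 2(4q₁Y + 16q₂Y² + 64q₃Y³ + 256q₄Y⁴ + 1024q₅Y⁵)/Y⁸ + 256 N_tot/((r/64)⁷ Y)`.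
[folklore] -/
theorem dyadic_NN_sum_le (NN : ℝ → ℝ) {Y r q₁ q₂ q₃ q₄ q₅ Ntot : ℝ} (hY : 3 ≤ Y) (hr : 192 ≤ r)
    (hq₁ : 0 ≤ q₁) (hq₂ : 0 ≤ q₂) (hq₃ : 0 ≤ q₃) (hq₄ : 0 ≤ q₄) (hq₅ : 0 ≤ q₅) (hN : 0 ≤ Ntot)
    (hnear : ∀ a, Y ≤ a → 32 * a ≤ r → NN a ≤ q₁ * a + q₂ * a ^ 2 + q₃ * a ^ 3 + q₄ * a ^ 4 + q₅ * a ^ 5)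
    (hfar : ∀ a, NN a ≤ Ntot) (K : ℕ) :
    ∑ n ∈ Finset.range (K + 1), ((2 : ℝ) ^ n * Y)⁻¹ ^ 8 * NN (2 ^ (n + 1) * Y + 3) ≤
      2 * (4 * q₁ * Y + 4 ^ 2 * q₂ * Y ^ 2 + 4 ^ 3 * q₃ * Y ^ 3 + 4 ^ 4 * q₄ * Y ^ 4 + 4 ^ 5 * q₅ * Y ^ 5) / Y ^ 8 +
        256 * Ntot / ((r / 64) ^ 7 * Y) := by
  have hY0 : 0 < Y := by linarith
  -- termwise split: near polynomial or far N_tot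
  have hterm : ∀ n : ℕ, ((2 : ℝ) ^ n * Y)⁻¹ ^ 8 * NN (2 ^ (n + 1) * Y + 3) ≤
      ((2 : ℝ) ^ n * Y)⁻¹ ^ 8 * (q₁ * (2 ^ (n + 1) * Y + 3) + q₂ * (2 ^ (n + 1) * Y + 3) ^ 2 +
        q₃ * (2 ^ (n + 1) * Y + 3) ^ 3 + q₄ * (2 ^ (n + 1) * Y + 3) ^ 4 + q₅ * (2 ^ (n + 1) * Y + 3) ^ 5) +
      Ntot * (if r < 32 * (2 ^ (n + 1) * Y + 3) then ((2 : ℝ) ^ n * Y)⁻¹ ^ 8 else 0) := by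
    intro n
    have hw0 : 0 ≤ ((2 : ℝ) ^ n * Y)⁻¹ ^ 8 := by positivity
    have ha : Y ≤ 2 ^ (n + 1) * Y + 3 := by
      have : (1 : ℝ) ≤ 2 ^ (n + 1) := one_le_pow₀ (by norm_num)
      nlinarith
    have hpoly0 : 0 ≤ q₁ * (2 ^ (n + 1) * Y + 3) + q₂ * (2 ^ (n + 1) * Y + 3) ^ 2 +
        q₃ * (2 ^ (n + 1) * Y + 3) ^ 3 + q₄ * (2 ^ (n + 1) * Y + 3) ^ 4 + q₅ * (2 ^ (n + 1) * Y + 3) ^ 5 := by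
      have : 0 ≤ 2 ^ (n + 1) * Y + 3 := by positivity
      positivity
    by_cases hcase : r < 32 * (2 ^ (n + 1) * Y + 3)
    · rw [if_pos hcase]
      calc _ ≤ ((2 : ℝ) ^ n * Y)⁻¹ ^ 8 * Ntot := mul_le_mul_of_nonneg_left (hfar _) hw0
        _ = Ntot * ((2 : ℝ) ^ n * Y)⁻¹ ^ 8 := mul_comm _ _
        _ ≤ _ := le_add_of_nonneg_left (mul_nonneg hw0 hpoly0)
    · rw [if_neg hcase, mul_zero, add_zero]
      exact mul_le_mul_of_nonneg_left (hnear _ ha (not_lt.1 hcase)) hw0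
  refine (Finset.sum_le_sum fun n _ => hterm n).trans ?_
  rw [Finset.sum_add_distrib, ← Finset.mul_sum]
  refine add_le_add ?_ ((mul_le_mul_of_nonneg_left (dyadic_far_sum_le hY0 hr K) hN).trans (le_of_eq (by ring)))
  -- the polynomial part, monomial by monomial
  have h1 := dyadic_monomial_sum_le hY (by norm_num : 1 ≤ 7) K
  have h2 := dyadic_monomial_sum_le hY (by norm_num : 2 ≤ 7) K
  have h3 := dyadic_monomial_sum_le hY (by norm_num : 3 ≤ 7) K
  have h4 := dyadic_monomial_sum_le hY (by norm_num : 4 ≤ 7) K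
  have h5 := dyadic_monomial_sum_le hY (by norm_num : 5 ≤ 7) K
  simp only [pow_one] at h1
  have hexp : ∑ n ∈ Finset.range (K + 1), ((2 : ℝ) ^ n * Y)⁻¹ ^ 8 * (q₁ * (2 ^ (n + 1) * Y + 3) + q₂ * (2 ^ (n + 1) * Y + 3) ^ 2 +
        q₃ * (2 ^ (n + 1) * Y + 3) ^ 3 + q₄ * (2 ^ (n + 1) * Y + 3) ^ 4 + q₅ * (2 ^ (n + 1) * Y + 3) ^ 5) =
      q₁ * ∑ n ∈ Finset.range (K + 1), ((2 : ℝ) ^ n * Y)⁻¹ ^ 8 * (2 ^ (n + 1) * Y + 3) +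
      q₂ * ∑ n ∈ Finset.range (K + 1), ((2 : ℝ) ^ n * Y)⁻¹ ^ 8 * (2 ^ (n + 1) * Y + 3) ^ 2 +
      q₃ * ∑ n ∈ Finset.range (K + 1), ((2 : ℝ) ^ n * Y)⁻¹ ^ 8 * (2 ^ (n + 1) * Y + 3) ^ 3 +
      q₄ * ∑ n ∈ Finset.range (K + 1), ((2 : ℝ) ^ n * Y)⁻¹ ^ 8 * (2 ^ (n + 1) * Y + 3) ^ 4 +
      q₅ * ∑ n ∈ Finset.range (K + 1), ((2 : ℝ) ^ n * Y)⁻¹ ^ 8 * (2 ^ (n + 1) * Y + 3) ^ 5 := by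
    simp only [Finset.mul_sum, ← Finset.sum_add_distrib]
    exact Finset.sum_congr rfl fun n _ => by ring
  rw [hexp]
  have e : 2 * (4 * q₁ * Y + 4 ^ 2 * q₂ * Y ^ 2 + 4 ^ 3 * q₃ * Y ^ 3 + 4 ^ 4 * q₄ * Y ^ 4 + 4 ^ 5 * q₅ * Y ^ 5) / Y ^ 8 =
      q₁ * (2 * 4 * Y / Y ^ 8) + q₂ * (2 * 4 ^ 2 * Y ^ 2 / Y ^ 8) + q₃ * (2 * 4 ^ 3 * Y ^ 3 / Y ^ 8) +
      q₄ * (2 * 4 ^ 4 * Y ^ 4 / Y ^ 8) + q₅ * (2 * 4 ^ 5 * Y ^ 5 / Y ^ 8) := by ring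
  rw [e]
  gcongr

end Summit.AtomisticToContinuum.Crystallization.Theorems.ExcessDecayLiouville

end
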